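/-
Copyright: cell pub-balaban-gaps, seat ne8 (estimate NE7c), gen 17. Project licence.
-/
import Literature.RepresentationTheory.CompactGroups.WeylIntegrationSpecialUnitary

/-!
# The `SU(N)` Hilbert–Schmidt ball as a CENTRAL TUBE of `U(N)`: `Haar_{SU(N)}{‖V − 1‖ ≤ δ} = m · Haar_{U(N)}{u : ‖ζ(u)⁻¹u − 1‖ ≤ δ, arg det u ∈ (a, a + 2π∕m]}`
# for every `m ≥ 1` and every admissible arc position `a` — step B0 of VALUING the small-ball constant `C₀(SU(N))` of this seat's file 36
# `LiveFactorWindowTightSUN.exists_tendsto_haar_sball_div_pow` for every `N` (row NE7c, HANDOFF § GEN 16 open point (vi′); [folklore])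

Cell `pub-balaban-gaps` (G2), seat ne8, estimate **NE7c**.  Proof-only file under `Spine/NE7c/`: imports the tree's
`Literature/RepresentationTheory/CompactGroups/WeylIntegrationSpecialUnitary` ONLY (the special part `specialPart u = ζ(u)⁻¹u`, `ζ(u) = e^{i·arg(det u)∕N}`, and
**`map_specialPart_haarProbability`**: `specialPart_* Haar_{U(N)} = Haar_{SU(N)}`, consumed BY NAME).  Mathlib otherwise.  No `def`; 0 `sorry`.

THE PLAN (vi′) (honest; this file is its first step, the others are NOT claimed here).  The tree VALUES the `U(N)` small-ball density
`c_N = lim Haar_{U(N)}(B_HS(1,δ))∕vol(b(0,δ)) = ∏_{j<N} j!∕(2π)^{N(N+1)∕2}` (`UnitaryHaarVolume.haarChartConst_eq`) and squeezes the Haar measure of `U(N)` in Cayley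
coordinates by `c_N·(1 ± o(1))·Lebesgue` on ALL subsets of small balls (`UnitaryCayleyChart.chartMeasure_le` ∕ `le_chartMeasure_of_subset`); the `SU(N)` constant
`C₀ = lim Haar_{SU(N)}{‖V − 1‖ ≤ δ}∕δ^{N²−1}` EXISTS (file 36, from `Summits/Ventures/LatticeQCDFlow/Scaling/SpecialUnitarySmallBall`) but is valued only at `N = 2`
(`asymptotic_const_SU2_eq`: `1∕(3√2·π)`).  Route: (B0, this file) transport the `SU(N)` ball to a TUBE SEGMENT of `U(N)` over a short arc of the central circle —
exactly, by the special-part pushforward and central translation; (B1) squeeze the tube segment in Cayley coordinates between cylinders `{X₀ + iφ1 : X₀ ∈ 𝔰𝔲(N),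
‖X₀‖ ≤ ρ, φ ∈ J}`; (B2) the cylinder volume `ω_{N²−1}ρ^{N²−1}·|J|·√N`; (B3) `C₀(SU(N)) = 2π·c_N·ω_{N²−1}∕√N = ω_{N²−1}·∏_{j<N} j!∕(√N·(2π)^{(N²+N−2)∕2})`.

THIS FILE ([folklore]):
* §1 the central circle: `centralPhase ψ = e^{iψ}·1 ∈ U(N)` (written as a subtype literal, no `def`), `det(e^{iψ}u) = e^{iNψ}·det u`, and the ARGUMENT SHIFT
  `arg det(e^{iψ}u) = arg det u + Nψ` while the shifted argument stays in `(−π, π]` (`arg_det_centralMul`);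
* §2 the special part is blind to the central circle: `specialPart (e^{iψ}u) = specialPart u` under the same no-wrap condition (`specialPart_centralMul`);
* §3 the TUBE SEGMENTS `T(δ; a, b) = {u : ‖specialPart u − 1‖ ≤ δ ∧ arg det u ∈ (a, b]}` are measurable, central translation maps `T(δ; a, b)` onto
  `T(δ; a + Nψ, b + Nψ)` (no wrap), so **`haar_tube_eq_of_shift`**: all admissible positions of an arc of given length have the same `U(N)`-Haar mass;
* §4 the preimage `specialPart⁻¹{‖V − 1‖ ≤ δ}` is the disjoint union of the `m` tube segments over the arcs `(−π + 2πk∕m, −π + 2π(k+1)∕m]`, hence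
  **`haar_sball_eq_mul_haar_tube`**: `Haar_{SU(N)}{‖V − 1‖ ≤ δ} = m · Haar_{U(N)} T(δ; a, a + 2π∕m)` for every `m ≥ 1`, `δ`, and `−π ≤ a ≤ π − 2π∕m`; in
  particular (`a = −π∕m`, `m ≥ 1`) the CENTRED form **`haar_sball_eq_mul_haar_centredTube`** with the arc `(−π∕m, π∕m]`, whose points are `u = e^{iφ}·W`,
  `W = specialPart u`, `|φ| ≤ π∕(Nm)` (`coe_eq_detPhase_smul` of the tree).

HONEST: Haar-measure bookkeeping on `U(N)` ∕ `SU(N)` ([folklore]); nothing of the interacting measure, nothing of Bałaban's; `C₀(SU(N))` is NOT valued in this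
file (steps B1–B3 outstanding); census-neutral for road (δ) (ratios only).  NE7c NOT proved; WORD UNCHANGED (WORK-bound behind node O; INSTANCE 0∕1); spine
0∕9; one finite T⁴ — NOT ℝ⁴, NOT infinite volume, NOT the mass gap, NOT Clay.
-/

set_option autoImplicit false

noncomputable section

open scoped Matrix.Norms.Frobenius Real ComplexConjugate
open MeasureTheory Set Filter Complex Finset
open Literature.MathematicalPhysics.QuantumFieldTheory (haarProbability)
open Literature.RepresentationTheory.CompactGroups.WeylIntegration (detPhase specialPart coe_specialPart measurable_specialPart
  map_specialPart_haarProbability norm_det_eq_one detPhase_ne_zero coe_eq_detPhase_smul)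

namespace Summit.QuantumFields.BalabanUV.T4Continuum.Spine.NE7c.LiveFactorSUNCentralTube

variable {N : ℕ}

/-! ## §1 The central circle of `U(N)` and the argument of the determinant -/

/-- `e^{iψ}·1` is unitary. [folklore] -/
theorem exp_smul_one_mem_unitaryGroup (ψ : ℝ) :
    cexp (ψ * I) • (1 : Matrix (Fin N) (Fin N) ℂ) ∈ Matrix.unitaryGroup (Fin N) ℂ := by
  rw [Matrix.mem_unitaryGroup_iff, star_smul, star_one, Matrix.smul_mul, Matrix.one_mul, smul_smul, Complex.star_def,
    Complex.mul_conj', Complex.norm_exp_ofReal_mul_I, Complex.ofReal_one, one_pow, one_smul]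

/-- the underlying matrix of the central translate `(e^{iψ}·1)·u` is `e^{iψ} • u`. [folklore] -/
theorem coe_centralMul (ψ : ℝ) (u : Matrix.unitaryGroup (Fin N) ℂ) :
    (((⟨cexp (ψ * I) • (1 : Matrix (Fin N) (Fin N) ℂ), exp_smul_one_mem_unitaryGroup ψ⟩ : Matrix.unitaryGroup (Fin N) ℂ) * u :
      Matrix.unitaryGroup (Fin N) ℂ) : Matrix (Fin N) (Fin N) ℂ) = cexp (ψ * I) • (u : Matrix (Fin N) (Fin N) ℂ) := by
  rw [Matrix.UnitaryGroup.mul_val]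
  change (cexp (ψ * I) • (1 : Matrix (Fin N) (Fin N) ℂ)) * (u : Matrix (Fin N) (Fin N) ℂ) = _
  rw [Matrix.smul_mul, Matrix.one_mul]

/-- `det(e^{iψ}•u) = e^{iNψ}·det u`. [folklore] -/
theorem det_exp_smul (ψ : ℝ) (u : Matrix (Fin N) (Fin N) ℂ) :
    (cexp (ψ * I) • u).det = cexp ((N * ψ : ℝ) * I) * u.det := by
  rw [Matrix.det_smul, Fintype.card_fin, ← Complex.exp_nat_mul]
  congr 2
  push_cast
  ring

/-- the determinant of a unitary matrix is `e^{i·arg det u}`. [folklore] -/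
theorem det_eq_exp_arg (u : Matrix.unitaryGroup (Fin N) ℂ) :
    (u : Matrix (Fin N) (Fin N) ℂ).det = cexp ((arg (u : Matrix (Fin N) (Fin N) ℂ).det : ℝ) * I) := by
  have h := Complex.norm_mul_exp_arg_mul_I (u : Matrix (Fin N) (Fin N) ℂ).det
  rw [norm_det_eq_one u.2, Complex.ofReal_one, one_mul] at h
  exact h.symm

/-- `det(e^{iψ}•u) = e^{i(arg det u + Nψ)}` for unitary `u`. [folklore] -/
theorem det_exp_smul_eq_exp_arg (ψ : ℝ) (u : Matrix.unitaryGroup (Fin N) ℂ) :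
    (cexp (ψ * I) • (u : Matrix (Fin N) (Fin N) ℂ)).det = cexp (((arg (u : Matrix (Fin N) (Fin N) ℂ).det + N * ψ : ℝ) : ℂ) * I) := by
  have h := det_eq_exp_arg u
  rw [det_exp_smul]
  conv_lhs => rw [h]
  rw [← Complex.exp_add]
  congr 1
  push_cast
  ring

/-- **THE ARGUMENT SHIFT**: if `arg det u + Nψ ∈ (−π, π]` then `arg det(e^{iψ}•u) = arg det u + Nψ`. [folklore] -/
theorem arg_det_exp_smul (ψ : ℝ) (u : Matrix.unitaryGroup (Fin N) ℂ)
    (h : arg (u : Matrix (Fin N) (Fin N) ℂ).det + N * ψ ∈ Set.Ioc (-π) π) :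
    arg (cexp (ψ * I) • (u : Matrix (Fin N) (Fin N) ℂ)).det = arg (u : Matrix (Fin N) (Fin N) ℂ).det + N * ψ := by
  rw [det_exp_smul_eq_exp_arg, Complex.arg_exp_mul_I, toIocMod_eq_self]
  exact ⟨h.1, by linarith [h.2]⟩

/-- the central translates compose: `(e^{−iψ}·1)·((e^{iψ}·1)·u) = u`. [folklore] -/
theorem centralMul_neg_centralMul (ψ : ℝ) (u : Matrix.unitaryGroup (Fin N) ℂ) :
    (⟨cexp ((-ψ : ℝ) * I) • (1 : Matrix (Fin N) (Fin N) ℂ), exp_smul_one_mem_unitaryGroup (-ψ)⟩ : Matrix.unitaryGroup (Fin N) ℂ) *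
        ((⟨cexp (ψ * I) • (1 : Matrix (Fin N) (Fin N) ℂ), exp_smul_one_mem_unitaryGroup ψ⟩ : Matrix.unitaryGroup (Fin N) ℂ) * u)
      = u := by
  apply Subtype.ext
  rw [coe_centralMul, coe_centralMul, smul_smul, ← Complex.exp_add]
  have : ((-ψ : ℝ) : ℂ) * I + (ψ : ℂ) * I = 0 := by push_cast; ring
  rw [this, Complex.exp_zero, one_smul]

/-! ## §2 The special part is blind to the central circle -/

/-- **`specialPart (e^{iψ}·u) = specialPart u`** whenever the argument does not wrap (`arg det u + Nψ ∈ (−π, π]`): the phase `ζ` picks up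
exactly `e^{iψ}` (`N ≥ 1`). [folklore] -/
theorem specialPart_centralMul [NeZero N] (ψ : ℝ) (u : Matrix.unitaryGroup (Fin N) ℂ)
    (h : arg (u : Matrix (Fin N) (Fin N) ℂ).det + N * ψ ∈ Set.Ioc (-π) π) :
    specialPart ((⟨cexp (ψ * I) • (1 : Matrix (Fin N) (Fin N) ℂ), exp_smul_one_mem_unitaryGroup ψ⟩ : Matrix.unitaryGroup (Fin N) ℂ) * u)
      = specialPart u := by
  have hN : (N : ℂ) ≠ 0 := Nat.cast_ne_zero.2 (NeZero.ne N)
  apply Subtype.ext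
  rw [coe_specialPart, coe_specialPart, coe_centralMul]
  -- the phase of the translate
  have hζ : detPhase (cexp (ψ * I) • (u : Matrix (Fin N) (Fin N) ℂ)) = cexp (ψ * I) * detPhase (u : Matrix (Fin N) (Fin N) ℂ) := by
    unfold detPhase
    rw [arg_det_exp_smul ψ u h, Fintype.card_fin, ← Complex.exp_add]
    congr 1
    push_cast
    field_simp
    ring
  have h1 := detPhase_ne_zero (u : Matrix (Fin N) (Fin N) ℂ)
  have h2 := Complex.exp_ne_zero ((ψ : ℂ) * I)
  rw [hζ, smul_smul]
  congr 1
  field_simp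

/-! ## §3 Tube segments over arcs of the central circle and their translation invariance -/

/-- the tube segments are measurable. [folklore] -/
theorem measurableSet_tube (δ a b : ℝ) :
    MeasurableSet {u : Matrix.unitaryGroup (Fin N) ℂ |
      ‖((specialPart u : Matrix.specialUnitaryGroup (Fin N) ℂ) : Matrix (Fin N) (Fin N) ℂ) - 1‖ ≤ δ ∧
        arg (u : Matrix (Fin N) (Fin N) ℂ).det ∈ Set.Ioc a b} := by
  refine MeasurableSet.inter ?_ ?_
  · have hc : Continuous fun V : Matrix.specialUnitaryGroup (Fin N) ℂ => ‖(V : Matrix (Fin N) (Fin N) ℂ) - 1‖ :=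
      (continuous_subtype_val.sub continuous_const).norm
    exact (measurableSet_le hc.measurable measurable_const).preimage measurable_specialPart
  · have hc : Continuous fun u : Matrix.unitaryGroup (Fin N) ℂ => (u : Matrix (Fin N) (Fin N) ℂ).det :=
      Continuous.matrix_det continuous_subtype_val
    exact (Complex.measurable_arg.comp hc.measurable) measurableSet_Ioc

/-- central translation maps a tube segment ONTO the shifted one (no wrap): the preimage of `T(δ; a + Nψ, b + Nψ)` under `u ↦ e^{iψ}·u` is
`T(δ; a, b)` when `−π ≤ a`, `b + Nψ ≤ π`, `−π ≤ a + Nψ` and `b ≤ π` (`N ≥ 1`). [folklore] -/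
theorem preimage_centralMul_tube [NeZero N] {δ a b ψ : ℝ} (ha : -π ≤ a) (hb : b ≤ π) (ha' : -π ≤ a + N * ψ)
    (hb' : b + N * ψ ≤ π) :
    (fun u : Matrix.unitaryGroup (Fin N) ℂ =>
        (⟨cexp (ψ * I) • (1 : Matrix (Fin N) (Fin N) ℂ), exp_smul_one_mem_unitaryGroup ψ⟩ : Matrix.unitaryGroup (Fin N) ℂ) * u) ⁻¹'
      {u : Matrix.unitaryGroup (Fin N) ℂ |
        ‖((specialPart u : Matrix.specialUnitaryGroup (Fin N) ℂ) : Matrix (Fin N) (Fin N) ℂ) - 1‖ ≤ δ ∧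
          arg (u : Matrix (Fin N) (Fin N) ℂ).det ∈ Set.Ioc (a + N * ψ) (b + N * ψ)}
    = {u : Matrix.unitaryGroup (Fin N) ℂ |
        ‖((specialPart u : Matrix.specialUnitaryGroup (Fin N) ℂ) : Matrix (Fin N) (Fin N) ℂ) - 1‖ ≤ δ ∧
          arg (u : Matrix (Fin N) (Fin N) ℂ).det ∈ Set.Ioc a b} := by
  ext u
  simp only [Set.mem_preimage, Set.mem_setOf_eq, Set.mem_Ioc]
  have harg := Complex.arg_mem_Ioc (u : Matrix (Fin N) (Fin N) ℂ).det
  constructor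
  · rintro ⟨hsp, h1, h2⟩
    -- translate back by `−ψ`: no wrap because `(a, b] ⊆ (−π, π]`
    set c : Matrix.unitaryGroup (Fin N) ℂ := ⟨cexp (ψ * I) • (1 : Matrix (Fin N) (Fin N) ℂ), exp_smul_one_mem_unitaryGroup ψ⟩ with hc
    have hw' : arg ((c * u : Matrix.unitaryGroup (Fin N) ℂ) : Matrix (Fin N) (Fin N) ℂ).det + N * (-ψ) ∈ Set.Ioc (-π) π :=
      ⟨by linarith, by linarith⟩
    have hargback := arg_det_exp_smul (-ψ) (c * u) hw'
    have hspback := specialPart_centralMul (-ψ) (c * u) hw'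
    rw [← coe_centralMul (-ψ) (c * u), centralMul_neg_centralMul ψ u] at hargback
    rw [centralMul_neg_centralMul ψ u] at hspback
    refine ⟨by rw [hspback]; exact hsp, ?_, ?_⟩
    · rw [hargback]; linarith
    · rw [hargback]; linarith
  · rintro ⟨hsp, h1, h2⟩
    have hw : arg (u : Matrix (Fin N) (Fin N) ℂ).det + N * ψ ∈ Set.Ioc (-π) π := ⟨by linarith, by linarith⟩
    rw [coe_centralMul, arg_det_exp_smul ψ u hw, specialPart_centralMul ψ u hw]
    exact ⟨hsp, by linarith, by linarith⟩

/-- **ALL ADMISSIBLE POSITIONS OF AN ARC CARRY THE SAME TUBE MASS**: for `−π ≤ a`, `b ≤ π`, `−π ≤ a + Nψ`, `b + Nψ ≤ π` (`N ≥ 1`),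
`Haar_{U(N)} T(δ; a + Nψ, b + Nψ) = Haar_{U(N)} T(δ; a, b)` (left invariance of Haar under the central translate). [folklore] -/
theorem haar_tube_eq_of_shift [NeZero N] {δ a b ψ : ℝ} (ha : -π ≤ a) (hb : b ≤ π) (ha' : -π ≤ a + N * ψ) (hb' : b + N * ψ ≤ π) :
    haarProbability (Matrix.unitaryGroup (Fin N) ℂ) {u : Matrix.unitaryGroup (Fin N) ℂ |
        ‖((specialPart u : Matrix.specialUnitaryGroup (Fin N) ℂ) : Matrix (Fin N) (Fin N) ℂ) - 1‖ ≤ δ ∧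
          arg (u : Matrix (Fin N) (Fin N) ℂ).det ∈ Set.Ioc (a + N * ψ) (b + N * ψ)}
    = haarProbability (Matrix.unitaryGroup (Fin N) ℂ) {u : Matrix.unitaryGroup (Fin N) ℂ |
        ‖((specialPart u : Matrix.specialUnitaryGroup (Fin N) ℂ) : Matrix (Fin N) (Fin N) ℂ) - 1‖ ≤ δ ∧
          arg (u : Matrix (Fin N) (Fin N) ℂ).det ∈ Set.Ioc a b} := by
  set c : Matrix.unitaryGroup (Fin N) ℂ := ⟨cexp (ψ * I) • (1 : Matrix (Fin N) (Fin N) ℂ), exp_smul_one_mem_unitaryGroup ψ⟩ with hc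
  have hpre := preimage_centralMul_tube (N := N) (δ := δ) ha hb ha' hb'
  rw [← hpre]
  exact (measure_preimage_mul (haarProbability (Matrix.unitaryGroup (Fin N) ℂ)) c _).symm
    |>.trans rfl |>.symm.trans rfl |>.symm

/-! ## §4 The `SU(N)` ball is `m` tube segments -/

/-- the preimage of the `SU(N)` ball under the special part is the union of the `m` tube segments over the arcs
`(−π + 2πk∕m, −π + 2π(k+1)∕m]`, `k < m` (`m ≥ 1`). [folklore] -/
theorem preimage_specialPart_sball_eq_iUnion {m : ℕ} (hm : 0 < m) (δ : ℝ) :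
    specialPart ⁻¹' {V : Matrix.specialUnitaryGroup (Fin N) ℂ | ‖(V : Matrix (Fin N) (Fin N) ℂ) - 1‖ ≤ δ}
      = ⋃ k ∈ Finset.range m, {u : Matrix.unitaryGroup (Fin N) ℂ |
          ‖((specialPart u : Matrix.specialUnitaryGroup (Fin N) ℂ) : Matrix (Fin N) (Fin N) ℂ) - 1‖ ≤ δ ∧
            arg (u : Matrix (Fin N) (Fin N) ℂ).det ∈ Set.Ioc (-π + 2 * π * k / m) (-π + 2 * π * (k + 1 : ℕ) / m)} := by
  ext u
  simp only [Set.mem_preimage, Set.mem_setOf_eq, Set.mem_iUnion, Finset.mem_range, exists_prop]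
  constructor
  · intro hu
    -- the arc index of `x = arg det u ∈ (−π, π]`
    set x := arg (u : Matrix (Fin N) (Fin N) ℂ).det with hx
    have harg := Complex.arg_mem_Ioc (u : Matrix (Fin N) (Fin N) ℂ).det
    rw [← hx] at harg
    have hm' : (0 : ℝ) < m := Nat.cast_pos.2 hm
    set t : ℝ := (x + π) * m / (2 * π) with ht
    have ht0 : 0 < t := by rw [ht]; exact div_pos (mul_pos (by linarith [harg.1]) hm') Real.two_pi_pos
    have htm : t ≤ m := by
      rw [ht, div_le_iff₀ Real.two_pi_pos]; nlinarith [harg.2]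
    refine ⟨⌈t⌉₊ - 1, ?_, hu, ?_, ?_⟩
    · have h1 : ⌈t⌉₊ ≤ m := Nat.ceil_le.2 htm
      have h2 : 0 < ⌈t⌉₊ := Nat.ceil_pos.2 ht0
      omega
    · -- lower end: `−π + 2π(⌈t⌉₊ − 1)∕m < x`
      have h2 : 0 < ⌈t⌉₊ := Nat.ceil_pos.2 ht0
      have hlt : ((⌈t⌉₊ - 1 : ℕ) : ℝ) < t := by
        have := Nat.ceil_lt_add_one ht0.le
        push_cast [Nat.cast_sub h2]
        linarith
      have : 2 * π * ((⌈t⌉₊ - 1 : ℕ) : ℝ) / m < x + π := by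
        rw [div_lt_iff₀ hm']
        calc 2 * π * ((⌈t⌉₊ - 1 : ℕ) : ℝ) < 2 * π * t := by nlinarith [Real.pi_pos]
          _ = (x + π) * m := by rw [ht]; field_simp
      linarith
    · -- upper end: `x ≤ −π + 2π⌈t⌉₊∕m`
      have h2 : 0 < ⌈t⌉₊ := Nat.ceil_pos.2 ht0
      have hle : t ≤ ((⌈t⌉₊ - 1 + 1 : ℕ) : ℝ) := by
        rw [Nat.sub_add_cancel h2]; exact Nat.le_ceil t
      have : x + π ≤ 2 * π * ((⌈t⌉₊ - 1 + 1 : ℕ) : ℝ) / m := by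
        rw [le_div_iff₀ hm']
        calc (x + π) * m = 2 * π * t := by rw [ht]; field_simp
          _ ≤ 2 * π * ((⌈t⌉₊ - 1 + 1 : ℕ) : ℝ) := by nlinarith [Real.pi_pos]
      linarith
  · rintro ⟨k, -, hu, -, -⟩
    exact hu

/-- the tube segments over distinct arcs of the partition are disjoint. [folklore] -/
theorem disjoint_tubes {m : ℕ} (hm : 0 < m) (δ : ℝ) {k k' : ℕ} (hkk' : k ≠ k') :
    Disjoint {u : Matrix.unitaryGroup (Fin N) ℂ |
          ‖((specialPart u : Matrix.specialUnitaryGroup (Fin N) ℂ) : Matrix (Fin N) (Fin N) ℂ) - 1‖ ≤ δ ∧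
            arg (u : Matrix (Fin N) (Fin N) ℂ).det ∈ Set.Ioc (-π + 2 * π * k / m) (-π + 2 * π * (k + 1 : ℕ) / m)}
      {u : Matrix.unitaryGroup (Fin N) ℂ |
          ‖((specialPart u : Matrix.specialUnitaryGroup (Fin N) ℂ) : Matrix (Fin N) (Fin N) ℂ) - 1‖ ≤ δ ∧
            arg (u : Matrix (Fin N) (Fin N) ℂ).det ∈ Set.Ioc (-π + 2 * π * k' / m) (-π + 2 * π * (k' + 1 : ℕ) / m)} := by
  rw [Set.disjoint_left]
  rintro u ⟨-, h1, h2⟩ ⟨-, h1', h2'⟩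
  have hm' : (0 : ℝ) < m := Nat.cast_pos.2 hm
  have hπ := Real.pi_pos
  -- `k < k' + 1` and `k' < k + 1` force `k = k'`
  have a1 : 2 * π * (k : ℝ) / m < 2 * π * ((k' + 1 : ℕ) : ℝ) / m := by linarith
  have a2 : 2 * π * (k' : ℝ) / m < 2 * π * ((k + 1 : ℕ) : ℝ) / m := by linarith
  rw [div_lt_div_iff_of_pos_right hm'] at a1 a2
  push_cast at a1 a2
  have b1 : (k : ℝ) < k' + 1 := by nlinarith
  have b2 : (k' : ℝ) < k + 1 := by nlinarith
  have c1 : k < k' + 1 := by exact_mod_cast b1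
  have c2 : k' < k + 1 := by exact_mod_cast b2
  omega

/-- **THE `SU(N)` BALL IS `m` TUBE SEGMENTS**: for every `m ≥ 1`, `δ`, and arc position `a` with `−π ≤ a ≤ π − 2π∕m` (`N ≥ 1`),
`Haar_{SU(N)}{‖V − 1‖ ≤ δ} = m · Haar_{U(N)}{u : ‖specialPart u − 1‖ ≤ δ ∧ arg det u ∈ (a, a + 2π∕m]}`. [folklore] -/
theorem haar_sball_eq_mul_haar_tube [NeZero N] {m : ℕ} (hm : 0 < m) (δ : ℝ) {a : ℝ} (ha : -π ≤ a) (ha' : a + 2 * π / m ≤ π) :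
    haarProbability (Matrix.specialUnitaryGroup (Fin N) ℂ)
        {V : Matrix.specialUnitaryGroup (Fin N) ℂ | ‖(V : Matrix (Fin N) (Fin N) ℂ) - 1‖ ≤ δ}
      = m * haarProbability (Matrix.unitaryGroup (Fin N) ℂ) {u : Matrix.unitaryGroup (Fin N) ℂ |
          ‖((specialPart u : Matrix.specialUnitaryGroup (Fin N) ℂ) : Matrix (Fin N) (Fin N) ℂ) - 1‖ ≤ δ ∧
            arg (u : Matrix (Fin N) (Fin N) ℂ).det ∈ Set.Ioc a (a + 2 * π / m)} := by
  have hm' : (0 : ℝ) < m := Nat.cast_pos.2 hm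
  have hN : (0 : ℝ) < N := Nat.cast_pos.2 (Nat.pos_of_ne_zero (NeZero.ne N))
  have hc : Continuous fun V : Matrix.specialUnitaryGroup (Fin N) ℂ => ‖(V : Matrix (Fin N) (Fin N) ℂ) - 1‖ :=
    (continuous_subtype_val.sub continuous_const).norm
  -- pushforward
  rw [← map_specialPart_haarProbability, Measure.map_apply measurable_specialPart (measurableSet_le hc.measurable measurable_const),
    preimage_specialPart_sball_eq_iUnion hm δ,
    measure_biUnion_finset (fun k _ k' _ hkk' => disjoint_tubes hm δ hkk') (fun k _ => measurableSet_tube _ _ _)]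
  -- every arc has the mass of the arc at position `a`
  have hk : ∀ k ∈ Finset.range m, haarProbability (Matrix.unitaryGroup (Fin N) ℂ) {u : Matrix.unitaryGroup (Fin N) ℂ |
        ‖((specialPart u : Matrix.specialUnitaryGroup (Fin N) ℂ) : Matrix (Fin N) (Fin N) ℂ) - 1‖ ≤ δ ∧
          arg (u : Matrix (Fin N) (Fin N) ℂ).det ∈ Set.Ioc (-π + 2 * π * k / m) (-π + 2 * π * (k + 1 : ℕ) / m)}
      = haarProbability (Matrix.unitaryGroup (Fin N) ℂ) {u : Matrix.unitaryGroup (Fin N) ℂ |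
          ‖((specialPart u : Matrix.specialUnitaryGroup (Fin N) ℂ) : Matrix (Fin N) (Fin N) ℂ) - 1‖ ≤ δ ∧
            arg (u : Matrix (Fin N) (Fin N) ℂ).det ∈ Set.Ioc a (a + 2 * π / m)} := by
    intro k hk
    rw [Finset.mem_range] at hk
    have hkm : (k : ℝ) + 1 ≤ m := by exact_mod_cast hk
    -- shift by `ψ = (−π + 2πk∕m − a)∕N`
    set ψ : ℝ := (-π + 2 * π * k / m - a) / N with hψ
    have h1 : a + N * ψ = -π + 2 * π * k / m := by rw [hψ]; field_simp; ring
    have h2 : a + 2 * π / m + N * ψ = -π + 2 * π * (k + 1 : ℕ) / m := by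
      rw [hψ]; push_cast; field_simp; ring
    have hlo : -π ≤ a + N * ψ := by
      rw [h1]; have : 0 ≤ 2 * π * k / m := by positivity
      linarith
    have hhi : a + 2 * π / m + N * ψ ≤ π := by
      rw [h2]; push_cast
      have : 2 * π * ((k : ℝ) + 1) / m ≤ 2 * π := by
        rw [div_le_iff₀ hm']; nlinarith [Real.pi_pos]
      linarith
    have := haar_tube_eq_of_shift (N := N) (δ := δ) ha ha' hlo hhi
    rw [h1, h2] at this
    exact this
  rw [Finset.sum_congr rfl hk, Finset.sum_const, Finset.card_range, nsmul_eq_mul]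

/-- **THE CENTRED FORM** (`m ≥ 1`, `N ≥ 1`): `Haar_{SU(N)}{‖V − 1‖ ≤ δ} = m · Haar_{U(N)}{u : ‖specialPart u − 1‖ ≤ δ ∧ arg det u ∈ (−π∕m, π∕m]}` — the
tube segment over the arc of half-width `π∕m` about `1`; its points are `u = e^{iφ}·specialPart u` with `φ = arg(det u)∕N`, `|φ| ≤ π∕(Nm)`
(the tree's `coe_eq_detPhase_smul`). [folklore] -/
theorem haar_sball_eq_mul_haar_centredTube [NeZero N] {m : ℕ} (hm : 0 < m) (δ : ℝ) :
    haarProbability (Matrix.specialUnitaryGroup (Fin N) ℂ)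
        {V : Matrix.specialUnitaryGroup (Fin N) ℂ | ‖(V : Matrix (Fin N) (Fin N) ℂ) - 1‖ ≤ δ}
      = m * haarProbability (Matrix.unitaryGroup (Fin N) ℂ) {u : Matrix.unitaryGroup (Fin N) ℂ |
          ‖((specialPart u : Matrix.specialUnitaryGroup (Fin N) ℂ) : Matrix (Fin N) (Fin N) ℂ) - 1‖ ≤ δ ∧
            arg (u : Matrix (Fin N) (Fin N) ℂ).det ∈ Set.Ioc (-(π / m)) (π / m)} := by
  have hm' : (0 : ℝ) < m := Nat.cast_pos.2 hm
  have hm1 : (1 : ℝ) ≤ m := by exact_mod_cast hm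
  have ha : -π ≤ -(π / m) := by
    have : π / m ≤ π := by rw [div_le_iff₀ hm']; nlinarith [Real.pi_pos]
    linarith
  have ha' : -(π / m) + 2 * π / m ≤ π := by
    have : -(π / m) + 2 * π / m = π / m := by ring
    rw [this, div_le_iff₀ hm']; nlinarith [Real.pi_pos]
  have h := haar_sball_eq_mul_haar_tube (N := N) hm δ ha ha'
  have heq : -(π / m) + 2 * π / m = π / m := by ring
  rw [heq] at h
  exact h

end Summit.QuantumFields.BalabanUV.T4Continuum.Spine.NE7c.LiveFactorSUNCentralTube
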